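/-
Copyright (c) 2026 the pub-hodgecm-mathlib formalisation cell (harness21).  Prover seat hodgecm-mathlib-K2E2-p12 (g5): Track B «K2-LIT», ENGINE E1,
h413 = stmt-HodgeConjecture-24833; «EIS-WHITTAKER-3» W3₃ (W-asm) sub-brick (U3C-c3-inert) «THE UNIT VALUE AT A GOOD NON-SPLIT PLACE» (dealer K2E1-plan (g5) 09:27:38Z (2)).
-/
import Summits.HodgeConjecture.HodgeConjecture.Theorems.K2E1WhittakerLocalRotationU3        -- ★ (this seat) (U3C-c2): `localWhittaker_mul_unit_eq` (+ ★ B1's token spelling)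
import Summits.HodgeConjecture.HodgeConjecture.Theorems.K2E1WhittakerLocalCharactersCM       -- ★ (this seat) (U3C-c1): `χ_w`, `adeleAddCharAt_quadraticLocalEquiv_mul_apply`
import Summits.HodgeConjecture.HodgeConjecture.Theorems.K2E1WhittakerLocalMeanInertU3        -- ★ B-inert (K2E1-p10): `integral_whittakerInertCell_pi_eq`, `ofReal_sq_cpow`
import Summits.HodgeConjecture.HodgeConjecture.Theorems.K2E1IntertwiningLocalMeanCMU3        -- ★ (this seat) (3-iii-b1): `pi_integralBox_toReal`, `placesOver_good`, `ε_v = −1` ★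
import Literature.NumberTheory.Automorphic.AdicCompletionResidueCard                         -- ★ `residueFieldCard_adicCompletion_eq`
import HarnessLib

/-!
# K2·E1 — `K2E1WhittakerLocalUnitValueInertU3` («EIS-WHITTAKER-3» W3₃, (W-asm) sub-brick (U3C-c3-inert)): THE UNIT VALUE OF THE LOCAL WHITTAKER TOKEN AT A GOOD
# NON-SPLIT PLACE — `W_v(ξ,z) = (1 − q_v^{−z})(1 − ε_v q_v^{−z})(1 − ε_v q_v^{−(2z−1)})` (`ε_v = −1`), for EVERY `ξ ∈ L^×` that is a unit above `v`

Track B ∕ K2-LIT, crux h413 = `stmt-HodgeConjecture-24833`, route of record `HCCMUnconditional`; cell `hodgecm-mathlib`, squad K2, ENGINE E1 (campaign «EIS-WHITTAKER-3», rung W3₃).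
THEOREMS ONLY (no `def`, no instance, no notation, no `sorry`; default heartbeats); lane `--supports stmt-HodgeConjecture-24833 --as helper` (count-neutral).  THE ASSEMBLY of
★ (U3C-c2) (rotate the frequency `ξ` by the unit `η = cξ·(1+δ)`: `ξη = N(ξ)·(1+δ)` has `{1,δ}`-coordinates `(N(ξ), N(ξ))`, units at a good place — the repair of the
generic-position flag for `ξ ∈ L⁺ ∪ δL⁺`), ★ (U3C-c1) (`ψ_{L,w}(Ψ_v(n,n)_w·Ψ_v(p₀,p₁)_w) = χ_w(p₀n)·χ_w(p₁dn)`), the dictionary `Q_v = 𝒲²` (★ `max_one_norm_height_eq_sq`), and ★ B-inert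
`integral_whittakerInertCell_pi_eq` at `ψ₁ = ψ₂ = χ_w`, `m₁ = m₂ = 0`, `(ξ₁, ξ₂) = (n, dn)`.
* `localWhittaker_integrand_eq_inertCell` (pointwise: ★ B1's integrand at the frequency `ξ·η` IS ★ B-inert's integrand), **`localWhittaker_eq_unit_of_nonsplit`** (HEAD):
  under `hw : c•w = w`, `v` unramified, `|2|_v = |δ|_w = |d|_v = 1`, `χ_w.HasConductorExp 0`, `n ∈ L⁺` with `n = ξ·cξ` and `|n|_v = 1`, `|cξ(1+δ)|_{w'} = |ξ(1−δ)|_{w'} = 1`: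
  `W_v(ξ,z) = (1 − q_v^{−z})(1 − ε_v q_v^{−z})(1 − ε_v q_v^{−(2z−1)})` for `1 < Re z` — ★ B1's token and ★ B1's unit value VERBATIM (`hW` of ★ (U3C-a)∕(U3C-b) at a non-split `v`).
HONEST LABEL: HC_CM is proved only modulo the 7 printed citations (2 remaining named inputs: hLiu418 = `stmt-HodgeConjecture-24832`, h413 = `stmt-HodgeConjecture-24833`) until rung 0
closes; this file asserts no named fact and closes no socket; count-neutral; unconditional.

## References
* [Rogawski1990] J. D. Rogawski, *Automorphic Representations of Unitary Groups in Three Variables* (1990): §4.5 (unramified Whittaker functions of `U(2,1)`).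
* [Langlands1971] R. P. Langlands, *Euler Products* (1971): §3.
* [TateThesis1967] J. Tate, *Fourier analysis in number fields and Hecke's zeta-functions* (1967): §2.2, Lemma 4.1.5.
-/

set_option autoImplicit false
set_option linter.dupNamespace false -- the mandated namespace repeats `HodgeConjecture.HodgeConjecture`

noncomputable section

open MeasureTheory NumberField IsDedekindDomain Filter
open scoped NNReal ENNReal
open Literature.NumberTheory.Automorphic Literature.NumberTheory.Automorphic.UnitaryGroup Literature.NumberTheory.GaloisRepresentations
open Literature.NumberTheory.GaloisRepresentations.IsNonarchimedeanLocalField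
open Summit.HodgeConjecture.HodgeConjecture.Cruxes.H413.K2E1IntertwiningLocalFactorU3Height (max_one_norm_height_eq_sq ne_one_of_apply_eq_neg quadraticLocalEquiv_apply_place)
open Summit.HodgeConjecture.HodgeConjecture.Cruxes.H413.K2E1WhittakerLocalCharactersCM
open Summit.HodgeConjecture.HodgeConjecture.Cruxes.H413.K2E1WhittakerLocalRotationU3 (localWhittaker_mul_unit_eq normAbs_eq_one_of_valued_eq_one)
open Summit.HodgeConjecture.HodgeConjecture.Cruxes.H413.K2E1WhittakerLocalMeanInertU3 (integral_whittakerInertCell_pi_eq ofReal_sq_cpow)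
open Summit.HodgeConjecture.HodgeConjecture.Cruxes.H413.K2E1IntertwiningLocalMeanCMU3 (pi_integralBox_toReal placesOver_good)
open Summit.HodgeConjecture.HodgeConjecture.Cruxes.H413.K2E1QuadraticHeckeCharCMPlaceValues (valueAtUniformizer_quadraticHeckeCharCM_of_nonsplit)

namespace Summit.HodgeConjecture.HodgeConjecture.Cruxes.H413.K2E1WhittakerLocalUnitValueInertU3

variable (L : Type) [Field L] [NumberField L] [IsCMField L] {δ : L} (hcδ : IsCMField.complexConj L δ = -δ) (hδ : δ ≠ 0)
  {d : ↥(maximalRealSubfield L)} (hd : δ * δ = algebraMap ↥(maximalRealSubfield L) L d) (v : HeightOneSpectrum (𝓞 ↥(maximalRealSubfield L))) (w : PlacesOver L v)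

include hd in
/-- **★ B1's INTEGRAND AT THE FREQUENCY `ξ·cξ(1+δ) = n(1+δ)` IS ★ B-inert's INTEGRAND** at a good non-split place: pointwise in `p`,
`Q_v(p)^{−z}·ψ_{L,w}((ξ·cξ(1+δ))·Ψ_v(p₀,p₁)_w) = 𝒲(p)^{−2z}·χ_w(p₀·n)·χ_w(p₁·(d·n))` (`Q_v = 𝒲²` ★, and ★ (U3C-c1)). [cite: Rogawski1990, §4.5] [cite: Langlands1971, §3] -/
theorem localWhittaker_integrand_eq_inertCell (hw : IsCMField.complexConj L • w.1 = w.1) (he : v.asIdeal.ramificationIdx' w.1.asIdeal = 1)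
    (h2 : Valued.v (2 : v.adicCompletion ↥(maximalRealSubfield L)) = 1) (hδu : Valued.v (algebraMap L (LocalRing L v) δ w) = 1) (hq : w.1.residueCard = v.residueCard ^ 2)
    (ξ : L) (n : ↥(maximalRealSubfield L)) (hn : algebraMap ↥(maximalRealSubfield L) L n = ξ * IsCMField.complexConj L ξ) (z : ℂ) (p : Fin 3 → v.adicCompletion ↥(maximalRealSubfield L)) :
    ((((∏ w' : PlacesOver L v, max 1 (max ((normAbs (w'.1.adicCompletion L) (quadraticLocalEquiv L v (IsCMField.complexConj L) hcδ hδ (p 0, p 1) w') : ℝ≥0) : ℝ)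
          ((normAbs (w'.1.adicCompletion L) ((toLocalRing L v (p 2) * algebraMap L (LocalRing L v) δ -
            toLocalRing L v 2⁻¹ * (quadraticLocalEquiv L v (IsCMField.complexConj L) hcδ hδ (p 0, p 1) *
              conjLocal L (IsCMField.complexConj L) v (quadraticLocalEquiv L v (IsCMField.complexConj L) hcδ hδ (p 0, p 1)))) w') : ℝ≥0) : ℝ))) : ℝ) : ℂ) ^ (-z)) *
              (∏ w' : PlacesOver L v, (adeleAddCharAt L w'.1 (((ξ * (IsCMField.complexConj L ξ * (1 + δ)) : L) : w'.1.adicCompletion L) * quadraticLocalEquiv L v (IsCMField.complexConj L) hcδ hδ (p 0, p 1) w') : ℂ)) =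
      ((((max 1 (max ((max ((normAbs (v.adicCompletion ↥(maximalRealSubfield L)) (p 0) : ℝ≥0) : ℝ) ((normAbs (v.adicCompletion ↥(maximalRealSubfield L)) (p 1) : ℝ≥0) : ℝ)) ^ 2) ((normAbs (v.adicCompletion ↥(maximalRealSubfield L)) (p 2) : ℝ≥0) : ℝ))) : ℝ) : ℂ) ^ (-(2 * z)) * ((((adeleAddCharAt L w.1).compAddMonoidHom (toPlace v w : v.adicCompletion ↥(maximalRealSubfield L) →+* w.1.adicCompletion L).toAddMonoidHom) (p 0 * (n : v.adicCompletion ↥(maximalRealSubfield L))) : Circle) : ℂ) *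
        ((((adeleAddCharAt L w.1).compAddMonoidHom (toPlace v w : v.adicCompletion ↥(maximalRealSubfield L) →+* w.1.adicCompletion L).toAddMonoidHom) (p 1 * ((d : v.adicCompletion ↥(maximalRealSubfield L)) * (n : v.adicCompletion ↥(maximalRealSubfield L)))) : Circle) : ℂ)) := by
  haveI : Algebra.IsQuadraticExtension ↥(maximalRealSubfield L) L := IsCMField.isQuadraticExtension L
  haveI : Subsingleton (PlacesOver L v) :=
    PlacesOver.subsingleton_of_smul_eq (IsCMField.complexConj L) (ne_one_of_apply_eq_neg L (IsCMField.complexConj L) hcδ hδ) w hw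
  -- the frequency `ξ·cξ(1+δ) = n + nδ = Ψ_v(n,n)` at `w`
  have hfreq : (((ξ * (IsCMField.complexConj L ξ * (1 + δ)) : L)) : w.1.adicCompletion L) =
      quadraticLocalEquiv L v (IsCMField.complexConj L) hcδ hδ ((n : v.adicCompletion ↥(maximalRealSubfield L)), (n : v.adicCompletion ↥(maximalRealSubfield L))) w := by
    rw [quadraticLocalEquiv_apply_place L (IsCMField.complexConj L) hcδ hδ v w, Pi.algebraMap_apply, toPlace_coe, hn,
      show ξ * (IsCMField.complexConj L ξ * (1 + δ)) = ξ * IsCMField.complexConj L ξ + ξ * IsCMField.complexConj L ξ * δ by ring]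
    show algebraMap L (w.1.adicCompletion L) (ξ * IsCMField.complexConj L ξ + ξ * IsCMField.complexConj L ξ * δ) =
      algebraMap L (w.1.adicCompletion L) (ξ * IsCMField.complexConj L ξ) + algebraMap L (w.1.adicCompletion L) (ξ * IsCMField.complexConj L ξ) * algebraMap L (w.1.adicCompletion L) δ
    simp only [map_add, map_mul]
  rw [Fintype.prod_subsingleton _ w, Fintype.prod_subsingleton _ w, hfreq,
    adeleAddCharAt_quadraticLocalEquiv_mul_apply L v w hcδ hδ hd hw, Circle.coe_mul,
    max_one_norm_height_eq_sq L (IsCMField.complexConj L) hcδ hδ hd v w hw he h2 hδu hq (p 0) (p 1) (p 2)]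
  have hpos : 0 < (max 1 (max ((max ((normAbs (v.adicCompletion ↥(maximalRealSubfield L)) (p 0) : ℝ≥0) : ℝ) ((normAbs (v.adicCompletion ↥(maximalRealSubfield L)) (p 1) : ℝ≥0) : ℝ)) ^ 2) ((normAbs (v.adicCompletion ↥(maximalRealSubfield L)) (p 2) : ℝ≥0) : ℝ))) := lt_of_lt_of_le zero_lt_one (le_max_left _ _)
  rw [ofReal_sq_cpow hpos, ← Complex.cpow_nat_mul, show ((2 : ℕ) : ℂ) * -z = -(2 * z) by push_cast; ring, mul_assoc]

variable [MeasurableSpace (v.adicCompletion ↥(maximalRealSubfield L))] [BorelSpace (v.adicCompletion ↥(maximalRealSubfield L))] (νv : Measure (v.adicCompletion ↥(maximalRealSubfield L))) [νv.IsAddHaarMeasure]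

include hd in
/-- **THE UNIT VALUE OF THE LOCAL WHITTAKER TOKEN AT A GOOD NON-SPLIT PLACE** (`ε_v = −1` ★): for `w ∣ v` non-split, `v` unramified in `L`, `|2|_v = |δ|_w = |d|_v = 1`,
`χ_w` of conductor exponent `0`, `ξ ∈ L` with `n = ξ·cξ ∈ L⁺` a `v`-unit and `cξ(1+δ)`, `ξ(1−δ)·…` units above `v` (the letters `hη`, `hcη` of ★ (U3C-c2)), and `1 < Re z`:
`W_v(ξ,z) = (1 − q_v^{−z})(1 − ε_v q_v^{−z})(1 − ε_v q_v^{−(2z−1)})` — ★ B1's token and unit value VERBATIM.  Proof: rotate (★ (U3C-c2)), identify the integrand (previous lemma),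
★ B-inert, `ν_v(𝒪_v³) = ν_v(𝒪_v)³` ★, `ε_v = −1` ★ and `(1−x)(1+x) = 1 − x²`. [cite: Rogawski1990, §4.5] [cite: Langlands1971, §3] [cite: TateThesis1967, Lemma 4.1.5] -/
theorem localWhittaker_eq_unit_of_nonsplit (hw : IsCMField.complexConj L • w.1 = w.1) (hunr : Algebra.IsUnramifiedIn (𝓞 L) v.asIdeal)
    (h2 : Valued.v (2 : v.adicCompletion ↥(maximalRealSubfield L)) = 1) (hδu : Valued.v (algebraMap L (LocalRing L v) δ w) = 1) (hdu : Valued.v ((d : v.adicCompletion ↥(maximalRealSubfield L))) = 1)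
    (hχ : ((adeleAddCharAt L w.1).compAddMonoidHom (toPlace v w : v.adicCompletion ↥(maximalRealSubfield L) →+* w.1.adicCompletion L).toAddMonoidHom).HasConductorExp 0)
    (ξ : L) (n : ↥(maximalRealSubfield L)) (hn : algebraMap ↥(maximalRealSubfield L) L n = ξ * IsCMField.complexConj L ξ) (hnu : Valued.v ((n : v.adicCompletion ↥(maximalRealSubfield L))) = 1)
    (hη : ∀ w' : PlacesOver L v, Valued.v (((IsCMField.complexConj L ξ * (1 + δ) : L)) : w'.1.adicCompletion L) = 1)
    (hcη : ∀ w' : PlacesOver L v, Valued.v (((IsCMField.complexConj L (IsCMField.complexConj L ξ * (1 + δ)) : L)) : w'.1.adicCompletion L) = 1)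
    {z : ℂ} (hz : 1 < z.re) :
    ((Measure.pi fun _ : Fin 3 => νv) (integralBox ↥(maximalRealSubfield L) (Fin 3) v)).toReal⁻¹ •
          ∫ p : Fin 3 → v.adicCompletion ↥(maximalRealSubfield L),
            ((((∏ w' : PlacesOver L v, max 1 (max ((normAbs (w'.1.adicCompletion L) (quadraticLocalEquiv L v (IsCMField.complexConj L) hcδ hδ (p 0, p 1) w') : ℝ≥0) : ℝ)
          ((normAbs (w'.1.adicCompletion L) ((toLocalRing L v (p 2) * algebraMap L (LocalRing L v) δ -
            toLocalRing L v 2⁻¹ * (quadraticLocalEquiv L v (IsCMField.complexConj L) hcδ hδ (p 0, p 1) *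
              conjLocal L (IsCMField.complexConj L) v (quadraticLocalEquiv L v (IsCMField.complexConj L) hcδ hδ (p 0, p 1)))) w') : ℝ≥0) : ℝ))) : ℝ) : ℂ) ^ (-z)) *
              (∏ w' : PlacesOver L v, (adeleAddCharAt L w'.1 (((ξ : L) : w'.1.adicCompletion L) * quadraticLocalEquiv L v (IsCMField.complexConj L) hcδ hδ (p 0, p 1) w') : ℂ))
            ∂(Measure.pi fun _ : Fin 3 => νv) =
      (1 - (v.residueCard : ℂ) ^ (-z)) * (1 - (quadraticHeckeCharCM L).valueAtUniformizer v * (v.residueCard : ℂ) ^ (-z)) *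
        (1 - (quadraticHeckeCharCM L).valueAtUniformizer v * (v.residueCard : ℂ) ^ (-(2 * z - 1))) := by
  haveI : Algebra.IsQuadraticExtension ↥(maximalRealSubfield L) L := IsCMField.isQuadraticExtension L
  obtain ⟨he, hq⟩ := placesOver_good L v hunr w
  rw [← localWhittaker_mul_unit_eq L hcδ hδ hd v νv (IsCMField.complexConj L ξ * (1 + δ)) hη hcη ξ z]
  simp_rw [localWhittaker_integrand_eq_inertCell L hcδ hδ hd v w hw he h2 hδu (hq hw) ξ n hn z]
  -- ★ B-inert at `ψ₁ = ψ₂ = χ_w`, `m = 0`, `ξ₁ = n`, `ξ₂ = dn`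
  have hmem : ∀ x : v.adicCompletion ↥(maximalRealSubfield L), Valued.v x = 1 → x ∈ primePowBall (v.adicCompletion ↥(maximalRealSubfield L)) 0 ∧ x ∉ primePowBall (v.adicCompletion ↥(maximalRealSubfield L)) (0 + 1) :=
    fun x hx => ⟨(mem_primePowBall_adicCompletion_iff v).2 (by rw [hx, neg_zero, WithZero.exp_zero]),
      fun h => by
        have h' := (mem_primePowBall_adicCompletion_iff v).1 h
        rw [hx, zero_add, ← WithZero.exp_zero, WithZero.exp_le_exp] at h'
        exact absurd h' (by norm_num)⟩
  have hdn : Valued.v ((d : v.adicCompletion ↥(maximalRealSubfield L)) * (n : v.adicCompletion ↥(maximalRealSubfield L))) = 1 := by rw [map_mul, hdu, hnu, one_mul]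
  rw [integral_whittakerInertCell_pi_eq νv (continuous_charComp L v w) (continuous_charComp L v w) hχ hχ (hmem _ hnu).1 (hmem _ hnu).2 (hmem _ hdn).1 (hmem _ hdn).2 hz,
    pi_integralBox_toReal L v νv, residueFieldCard_adicCompletion_eq, valueAtUniformizer_quadraticHeckeCharCM_of_nonsplit L v w hw hunr, Complex.real_smul,
    ← mul_assoc, Complex.ofReal_inv, Complex.ofReal_pow, inv_mul_cancel₀ (pow_ne_zero 3 (by exact_mod_cast (LocalFieldHaar.measureReal_primePowBall_pos νv 0).ne')),
    one_mul, show -(2 * z) = ((2 : ℕ) : ℂ) * -z by push_cast; ring, Complex.cpow_nat_mul]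
  ring

end Summit.HodgeConjecture.HodgeConjecture.Cruxes.H413.K2E1WhittakerLocalUnitValueInertU3

end
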